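/-
Copyright: seat `ym-line-cbag-p2` (prover-ym-line-cbag-p2-g0-0), route `ColdBoxAllGroups`, crux `BulkAllGroups`
(stmt-QuantumFields-22255), line `dlr-chessboard-G` (skeleton `Cruxes/BulkAllGroups/Lines/birth.lean`).
-/
import Summits.QuantumFields.YangMills.Theorems.ColdBoxAllGroupsDefs
import Summits.QuantumFields.YangMills.Theorems.WeakCouplingRatesBulkDominatesColdBoxWFlatCovOfDomAbs

/-!
# Crux `BulkAllGroups` (stmt-QuantumFields-22255): stub N2-flat-G `stub_flatCovExpansionG` REDUCED to the ABSOLUTE Dirichlet domination of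
# the cold-wall box — the ONE one-scale statement shared with the sibling crux BOX_G (`BoxFloorAllGroups`, stmt-QuantumFields-22254)

In the `SU(2)` route ONE theorem, `boxDirichletDominationAbs` (`|β²·boxPlaqCov β H T − ¾·boxDirCircSqCov H T| ≤ β^{−κ}` for all `T ≤ H = ⌈β^θ⌉`,
`κ > 8θ`, `θ ≤ θ₀`; the natural output of the one-scale expansion of the cold-wall box against its OWN temporal-gauge Dirichlet linearisation),
served BOTH cruxes: BOX_W's registered relative form via `stub_boxGaussianDomination_of_abs` (`WeakCouplingRatesColdBoxStubOfAbs`) and BULK_W's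
`FlatCovExpansion` via `flatCovExpansion_of_domAbs`.  This file is the G-port of the latter: for ANY `ρ` (`D = dimE ρ` chart coordinates, Gaussian
constant `D/4` in place of `¾ = 3/4`), the absolute Dirichlet domination along a ceiling implies `FlatCovExpansionG ρ (θ/20) θ` below the same
ceiling (`(D/4)·boxDirCircSqCov = (D/2)·C_D²` by the Dirichlet Wick identity `boxDirCircSqCov_eq_two_mul_sq` and `boxDirProjKernel_centre_eq`;
`β^{−κ} ≤ β^{−θ/2}`).  The hypothesis is stated INLINE in exactly the shape a G-port of `boxDirichletDominationAbs` will have, so that the lead of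
crux 22254 and this line prove ONE statement (`stub_boxDirichletDominationAbsG` of skeleton v4).  No new definition; standard axioms.  NOT a claim
about the mass gap; the Yang–Mills mass gap is NOT proved by any of this.
-/

set_option autoImplicit false

noncomputable section

open Literature.MathematicalPhysics.QuantumLattice
open Literature.MathematicalPhysics.QuantumFieldTheory
open Summit.QuantumFields.YangMills.Theorems.WeakCouplingRates
open Summit.QuantumFields.YangMills.Theorems.FreeEnergyLogCoefficient (dimE)

namespace Summit.QuantumFields.YangMills.Theorems.ColdBoxAllGroups

variable {N : ℕ} {G : Type*} [Group G] [TopologicalSpace G] [IsTopologicalGroup G] [CompactSpace G]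
  [MeasurableSpace G] [BorelSpace G]
variable (ρ : G →* Matrix (Fin N) (Fin N) ℂ)

/-- **`stub_flatCovExpansionG` ⇐ absolute Dirichlet domination**, any `ρ` (`D = dimE ρ`): if below a ceiling `θ₀` the cold-wall box covariance is
within `β^{−κ}`, `κ > 8θ`, of `(D/4)·boxDirCircSqCov H T` for all `T ≤ H = ⌈β^θ⌉`, then `FlatCovExpansionG ρ (θ/20) θ` for every `0 < θ ≤ θ₀`
(G-port of `flatCovExpansion_of_domAbs`). [folklore] -/
theorem flatCovExpansionG_of_domAbsG
    (habs : ∃ θ₀ : ℝ, 0 < θ₀ ∧ ∀ θ : ℝ, 0 < θ → θ ≤ θ₀ → ∃ κ : ℝ, 8 * θ < κ ∧ ∃ β₀ : ℝ, ∀ β : ℝ, β₀ ≤ β →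
      ∀ T : ℕ, T ≤ ⌈β ^ θ⌉₊ →
        |β ^ 2 * boxPlaqCov ρ β ⌈β ^ θ⌉₊ T - (dimE ρ : ℝ) / 4 * boxDirCircSqCov ⌈β ^ θ⌉₊ T| ≤ β ^ (-κ)) :
    ∃ θ₂ : ℝ, 0 < θ₂ ∧ ∀ θ : ℝ, 0 < θ → θ ≤ θ₂ → FlatCovExpansionG ρ (θ / 20) θ := by
  obtain ⟨θ₀, hθ₀, habs⟩ := habs
  refine ⟨θ₀, hθ₀, fun θ hθ hθle => ?_⟩
  obtain ⟨κ, hκ, β₁, h₁⟩ := habs θ hθ hθle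
  unfold FlatCovExpansionG
  refine ⟨max β₁ 1, fun β hβ => ?_⟩
  have hβ₁ : β₁ ≤ β := le_trans (le_max_left _ _) hβ
  have hβ1 : (1 : ℝ) ≤ β := le_trans (le_max_right _ _) hβ
  -- `T = ⌈β^{θ/20}⌉ ≤ ⌈β^θ⌉`
  have hT : ⌈β ^ (θ / 20)⌉₊ ≤ ⌈β ^ θ⌉₊ :=
    Nat.ceil_mono (Real.rpow_le_rpow_of_exponent_le hβ1 (by linarith))
  have h := h₁ β hβ₁ ⌈β ^ (θ / 20)⌉₊ hT
  -- `(D/4)·boxDirCircSqCov = (D/2)·C_D²`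
  rw [boxDirCircSqCov_eq_two_mul_sq, ← boxDirProjKernel_centre_eq] at h
  set K : ℝ := boxDirProjKernel ⌈β ^ θ⌉₊ (boxCentre ⌈β ^ θ⌉₊, 1, 2)
    (boxCentre ⌈β ^ θ⌉₊ + Pi.single 0 (⌈β ^ (θ / 20)⌉₊ : ℤ), 1, 2) with hK
  have h34 : (dimE ρ : ℝ) / 4 * (2 * K ^ 2) = (dimE ρ : ℝ) / 2 * K ^ 2 := by ring
  rw [h34] at h
  have hpow : β ^ (-κ) ≤ β ^ (-(θ / 2)) := Real.rpow_le_rpow_of_exponent_le hβ1 (by linarith)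
  exact h.trans hpow

/-- **The registered N2-flat-G stub from the shared absolute statement** (skeleton v4 of crux 22255: `stub_boxDirichletDominationAbsG` is the ONE
one-scale flat-datum statement of the route, to be proved jointly with crux 22254): instance-binder form, every compact simple `G`, every `r`.
[folklore] -/
theorem stub_flatCovExpansionG_of_domAbsG
    (habs : ∀ (G : Type) [Group G] [TopologicalSpace G] [IsTopologicalGroup G] [CompactSpace G] [MeasurableSpace G] [BorelSpace G],
      IsCompactSimpleLieGroup G → ∀ r : LatticeRep G, ∃ θ₀ : ℝ, 0 < θ₀ ∧ ∀ θ : ℝ, 0 < θ → θ ≤ θ₀ → ∃ κ : ℝ, 8 * θ < κ ∧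
        ∃ β₀ : ℝ, ∀ β : ℝ, β₀ ≤ β → ∀ T : ℕ, T ≤ ⌈β ^ θ⌉₊ →
          |β ^ 2 * boxPlaqCov r.ρ β ⌈β ^ θ⌉₊ T - (dimE r.ρ : ℝ) / 4 * boxDirCircSqCov ⌈β ^ θ⌉₊ T| ≤ β ^ (-κ)) :
    ∀ (G : Type) [Group G] [TopologicalSpace G] [IsTopologicalGroup G] [CompactSpace G] [MeasurableSpace G] [BorelSpace G],
    IsCompactSimpleLieGroup G → ∀ r : LatticeRep G, ∃ θ₃ : ℝ, 0 < θ₃ ∧ ∀ θ : ℝ, 0 < θ → θ ≤ θ₃ →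
      FlatCovExpansionG r.ρ (θ / 20) θ :=
  fun G _ _ _ _ _ _ hG r => flatCovExpansionG_of_domAbsG r.ρ (habs G hG r)

end Summit.QuantumFields.YangMills.Theorems.ColdBoxAllGroups

end
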